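import Summits.CriticalPhenomena.PercolationContinuityZ3.Theorems.FK.Transplant.UFSC0SlabCriticality
import Summits.CriticalPhenomena.PercolationContinuityZ3.Theorems.FK.Transplant.UFSC0FreeSlab
import HarnessLib

/-!
# FRONTIER TRANSPLANT — K1 in finite form (K1-FIN), consumer corollaries: crux C3a(q) ⟺ T_F(q) ∧ Conj. (5.103)_q EXACTLY,
# and `inf {p : ∃ r, UFSC0} = p̂_c(q)` — the cell's END STATE in printed objects

Support file (`--supports stmt-CriticalPhenomena-4575`, helper) of the FRONTIER TRANSPLANT sub-cell
(`fk-continuity/transplant/`, seat `prim-bschramm-fkt-p3`); builds on p205010 (kernel theorem, internal audit signed;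
external expert review pending). Memo row K1-FIN [g130, R67] (bytes-first package, file 10 = the two corollaries R67 names
as "typed at conversion"). 0 definitions · 0 named facts · 0 sorries · standard axioms; `FH` does not occur in this file.
Registered R70 (cell INBOX l.5267, 2026-08-23); registry row T4k; lead label T4k-10 (fkt-lead L44, l.5255).

HONEST FRAMING (page 1, cell rule). The transplant's theorem of record `ufsc0_of_freeBoundaryHypothesis_r3` is CONDITIONAL on FH
AND on TP_FK, both OPEN at the same `p` for `q > 1` near `p_c(q)` (⇔ GRC Conj. (5.103) via K1; barrier note
`Literature.Barriers.CriticalPhenomena.SamePFreeBoundaryCriteria`, FBN-01); the transplant is a typed reduction, not a proof of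
FK continuity. THIS FILE only sharpens the landed calibration leaf T4c-A (`UFSC0SlabCriticality`) by K1-FIN (file 9
`UFSC0FreeSlab`): T4c-A §2's GAP CLAUSE "UFSC0 at every `p ∈ (p_c(q), p̂_c(q)] ∩ (0,1)`" IS Conjecture (5.103)_q
(`p̂_c(q) = p_c(q)`), and T4c-A §4's interval `[p_c(q), p̂_c(q)]` for the threshold of the record's conclusion collapses to the
point `p̂_c(q)`. NOT a discharge of FH or TP_FK, NOT `_r4`; `_r3` « 2 / 0 ☑ », n_open = 2 unchanged. Nothing at `p = p_c(q)`.

## What is here (namespace `Summit.CriticalPhenomena.PercolationContinuityZ3.Theorems.FK`)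

* `fkCriterionOfThetaFree_iff_fkContinuityFree_and_slabThreshold_eq` — `d ≥ 3`, `q ≥ 1`, `0 < ε₀`, `4ε₀ < 2⁻³²`:
  `FKCriterionOfThetaFree d q ε₀ ↔ FKContinuityFree d q ∧ fkSlabCriticalProb d q = rcCriticalProb d q` — crux C3a(q) is EXACTLY
  the continuity target T_F(q) (FO-12) plus Grimmett's Conjecture (5.103) for this `q`; UNCONDITIONAL (T4c-A had "↔ T_F" only
  under the displayed (5.103)_q, and "↔ T_F ∧ gap clause" unconditionally).
* `csInf_ufsc0Set_eq_fkSlabCriticalProb` — `inf {p ∈ (0,1] : ∃ r, UFSC0 d q p r ε₀} = p̂_c(q)` (T4c-A §4 gave `∈ [p_c(q), p̂_c(q)]`).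

## References

* G. Grimmett, *The Random-Cluster Model*, Springer 2006, §5.7 eq. (5.102), Conj. (5.103) [Grimmett2006].
* G. Kozma, S. Nitzan, arXiv:2401.12397 (2024), §4 Theorem 6 [KozmaNitzan2024].
-/

noncomputable section

open MeasureTheory
open scoped ENNReal Classical

namespace Summit.CriticalPhenomena.PercolationContinuityZ3.Theorems.FK

open Literature.Probability.Percolation Literature.Probability.LatticeModels
open Literature.Probability.Percolation.KozmaNitzan Literature.Barriers.CriticalPhenomena

variable {d : ℕ} {q ε₀ : ℝ}

/-- **Crux C3a(q) ⟺ T_F(q) ∧ (5.103)_q, unconditionally** (`d ≥ 3`, `q ≥ 1`, `0 < ε₀`, `4ε₀ < 2⁻³²`). (→) T4c-A's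
`fkCriterionOfThetaFree_iff_fkContinuityFree_and_gap` gives T_F and `UFSC0` at every `p ∈ (p_c(q), p̂_c(q)] ∩ (0,1)`; by K1-FIN
(`fkSlabCriticalProb_le_of_ufsc0`) such a `p` has `p̂_c(q) ≤ p`, so the open interval `(p_c(q), p̂_c(q))` is empty, i.e.
`p̂_c(q) ≤ p_c(q)`, and `p_c(q) ≤ p̂_c(q)` always. (←) T4c-A's `fkCriterionOfThetaFree_iff_fkContinuityFree_of_slabThreshold_eq`.
[cite: Grimmett2006, §5.7 eq. (5.102), Conj. (5.103); KozmaNitzan2024, §4 Theorem 6] -/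
theorem fkCriterionOfThetaFree_iff_fkContinuityFree_and_slabThreshold_eq (hd : 3 ≤ d) (hq : 1 ≤ q) (hε₀ : 0 < ε₀)
    (hε : 4 * ε₀ < (1 / 2 : ℝ) ^ 32) :
    FKCriterionOfThetaFree d q ε₀ ↔ FKContinuityFree d q ∧ fkSlabCriticalProb d q = rcCriticalProb d q := by
  constructor
  · intro h3a
    obtain ⟨hT, hgap⟩ := (fkCriterionOfThetaFree_iff_fkContinuityFree_and_gap hd hq hε₀ hε).1 h3a
    refine ⟨hT, le_antisymm ?_ (rcCriticalProb_le_fkSlabCriticalProb (by omega) hq)⟩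
    by_contra hlt
    push Not at hlt
    -- a point strictly inside the gap
    obtain ⟨x, hx1, hx2⟩ := exists_between hlt
    have hx0 : 0 < x := (rcCriticalProb_pos (d := d) (by omega) hq).trans hx1
    have hxlt1 : x < 1 := hx2.trans (fkSlabCriticalProb_lt_one (d := d) (by omega) hq)
    obtain ⟨r, hU⟩ := hgap ⟨x, hx0.le, hxlt1.le⟩ hx1 hx2.le hxlt1
    have hle := fkSlabCriticalProb_le_of_ufsc0 hq hε.le (p := ⟨x, hx0.le, hxlt1.le⟩) hx0 hU
    exact absurd hle (not_le.2 hx2)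
  · rintro ⟨hT, h5103⟩
    exact (fkCriterionOfThetaFree_iff_fkContinuityFree_of_slabThreshold_eq hd hq hε₀ hε h5103).2 hT

/-- **The threshold of the record's conclusion IS the slab threshold**: `inf {p ∈ (0,1] : ∃ r, UFSC0 d q p r ε₀} = p̂_c(q)`
(`d ≥ 3`, `q ≥ 1`, `0 < ε₀`, `4ε₀ < 2⁻³²`): `≤` is T4c-A's `csInf_ufsc0Set_mem_Icc` (T4s above `p̂_c(q)`); `≥` is K1-FIN
(`fkSlabCriticalProb_le_of_ufsc0`: every point of the set is `≥ p̂_c(q)`).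
[cite: Grimmett2006, §5.7 eq. (5.102), Conj. (5.103); KozmaNitzan2024, §4 Theorem 6] -/
theorem csInf_ufsc0Set_eq_fkSlabCriticalProb (hd : 3 ≤ d) (hq : 1 ≤ q) (hε₀ : 0 < ε₀) (hε : 4 * ε₀ < (1 / 2 : ℝ) ^ 32) :
    sInf {x : ℝ | ∃ p : unitInterval, (p : ℝ) = x ∧ 0 < x ∧ ∃ r : ℕ, UFSC0 d q p r ε₀} = fkSlabCriticalProb d q := by
  set U : Set ℝ := {x : ℝ | ∃ p : unitInterval, (p : ℝ) = x ∧ 0 < x ∧ ∃ r : ℕ, UFSC0 d q p r ε₀} with hU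
  have hq0 : 0 < q := one_pos.trans_le hq
  refine le_antisymm (csInf_ufsc0Set_mem_Icc hd hq hε₀ hε).2 ?_
  -- `U` is nonempty: every `x ∈ (p̂_c(q), 1)` is in `U`
  have hsc1 : fkSlabCriticalProb d q < 1 := fkSlabCriticalProb_lt_one (d := d) (by omega) hq
  have hsc0 : 0 ≤ fkSlabCriticalProb d q := (fkSlabCriticalProb_mem_Icc (d := d) hq0).1
  obtain ⟨x₀, hx₀, hx₀1⟩ := exists_between hsc1
  have hx₀0 : 0 < x₀ := hsc0.trans_lt hx₀
  have hne : U.Nonempty := ⟨x₀, ⟨x₀, hx₀0.le, hx₀1.le⟩, rfl, hx₀0,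
    ufsc0_of_fkSlabCriticalProb_lt hd hq hε₀ ⟨x₀, hx₀0.le, hx₀1.le⟩ ⟨hx₀0, hx₀1⟩ hx₀⟩
  refine le_csInf hne fun x hx => ?_
  obtain ⟨p, hpx, hx0, r, hUp⟩ := hx
  subst hpx
  exact fkSlabCriticalProb_le_of_ufsc0 hq hε.le hx0 hUp

end Summit.CriticalPhenomena.PercolationContinuityZ3.Theorems.FK

end
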